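import Literature.AlgebraicGeometry.Motives.UniversalHypersurfaceRegularLocusChart
import Literature.NumberTheory.Transcendental.ProjectiveSpaceT2Proofs
import HarnessLib

/-!
# Functions of the chart coordinates with bounded affine support extend by zero to `C^∞` functions on `𝒴°(ℂ)`

Family `hodge`, layer `Literature/AlgebraicGeometry/Motives`; sequel of `UniversalHypersurfaceRegularLocusChart` (the `C^∞` charts
`regChartFun n d i = (b', z/zᵢ)` of the regular locus `𝒴°(ℂ)` on `𝒴°(ℂ)ᵢ = {zᵢ ≠ 0}`). The auxiliary functions of the degeneration programme
(`HodgeTheory/CyclicCoverNodalMeridianLocalMonodromyBound`: the Morse radius `Σ|Θ(y)|²`, bumps around the node) are given in the affine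
coordinates `y = z/zᵢ` of ONE chart and must become global smooth functions on the manifold `𝒴°(ℂ)`. This file provides the extension:

* `isCompact_stdChartInv_image_closedBall`, `isClosed_setOf_hypersurfacePoint_mem_image` — the points of `𝒴°(ℂ)` whose homogeneous
  coordinates lie in the (compact) image of a closed ball of the `i`-th affine chart form a CLOSED subset of `𝒴°(ℂ)` contained in `𝒴°(ℂ)ᵢ`;
* `regChartExtend n d i B` — `Q ↦ B(regChartFun Q)` on `𝒴°(ℂ)ᵢ`, `0` elsewhere;
* `tsupport_regChartExtend_subset` — if `B(b', y) = 0` whenever `‖y‖ > R`, its topological support lies in that closed set, inside `𝒴°(ℂ)ᵢ`;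
* `contMDiff_regChartExtend` — hence **`regChartExtend n d i B` is `C^∞` on all of `𝒴°(ℂ)`** for `B` `C^∞` (`contMDiffAt_of_notMem` off the
  support, the chart on it); `regChartExtend_of_mem` — it equals `B ∘ regChartFun` on `𝒴°(ℂ)ᵢ`.

Everything is proved; the one definition (`regChartExtend`) is concrete; no named facts.

## References

* [SerreGAGA1956] J.-P. Serre, Géométrie algébrique et géométrie analytique, Ann. Inst. Fourier 6 (1956), §2 n°5–6.
* [BrockerJanichIDT1982] T. Bröcker, K. Jänich, Introduction to Differential Topology (1982), §7 (bump functions, extension by zero).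
-/

noncomputable section

open CategoryTheory AlgebraicGeometry TopologicalSpace Set Topology
open scoped Manifold ContDiff LinearAlgebra.Projectivization
open Literature.AlgebraicGeometry.HodgeTheory Literature.NumberTheory.Transcendental

namespace Literature.AlgebraicGeometry.Motives.UniversalHypersurface

variable (n d : ℕ) (i : Fin (n + 2))

/-! ### The closed sets `{[z] ∈ stdChartInv i (closedBall 0 R)}` -/

/-- The image of a closed ball of the `i`-th affine chart in `ℙ(ℂⁿ⁺²)` is compact. [cite: SerreGAGA1956, §2 n°5] -/
theorem isCompact_stdChartInv_image_closedBall (R : ℝ) :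
    IsCompact (Projectivization.stdChartInv i '' Metric.closedBall (0 : Fin (n + 1) → ℂ) R) :=
  (isCompact_closedBall _ _).image (Projectivization.continuous_stdChartInv i)

/-- That image lies in the chart domain `Uᵢ`. [cite: SerreGAGA1956, §2 n°5] -/
theorem stdChartInv_image_subset_source (R : ℝ) :
    Projectivization.stdChartInv i '' Metric.closedBall (0 : Fin (n + 1) → ℂ) R ⊆ (Projectivization.stdChart i).source := by
  rintro _ ⟨w, -, rfl⟩
  rw [Projectivization.stdChart_source]
  exact Projectivization.stdChartInv_mem_stdChartSource i w

/-- **The points of `𝒴°(ℂ)` with homogeneous coordinates in `stdChartInv i (closedBall 0 R)` form a closed set** (preimage of a compact,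
hence closed, subset of the Hausdorff `ℙ(ℂⁿ⁺²)`). [cite: SerreGAGA1956, §2 n°5] -/
theorem isClosed_setOf_hypersurfacePoint_mem_image (R : ℝ) :
    IsClosed {Q : ComplexPoints (regularTotal ℂ n d) |
      hypersurfacePoint (regularToProjectiveSpace ℂ n d) Q ∈
        Projectivization.stdChartInv i '' Metric.closedBall (0 : Fin (n + 1) → ℂ) R} := by
  haveI : T2Space (ℙ ℂ (Fin (n + 2) → ℂ)) := Projectivization.t2Space_pi
  exact ((isCompact_stdChartInv_image_closedBall n i R).isClosed).preimage (continuous_hypersurfacePoint _)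

/-- That closed set lies in the chart domain `𝒴°(ℂ)ᵢ`. [cite: SerreGAGA1956, §2 n°5] -/
theorem setOf_hypersurfacePoint_mem_image_subset_regChartDom (R : ℝ) :
    {Q : ComplexPoints (regularTotal ℂ n d) |
      hypersurfacePoint (regularToProjectiveSpace ℂ n d) Q ∈
        Projectivization.stdChartInv i '' Metric.closedBall (0 : Fin (n + 1) → ℂ) R} ⊆ regChartDom n d i := by
  intro Q hQ
  rw [regChartDom_eq_preimage]
  exact stdChartInv_image_subset_source n i R hQ

/-- A point of `𝒴°(ℂ)ᵢ` whose affine coordinates have norm `≤ R` lies in that closed set. [cite: SerreGAGA1956, §2 n°5] -/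
theorem mem_setOf_hypersurfacePoint_mem_image {R : ℝ} {Q : ComplexPoints (regularTotal ℂ n d)} (hQ : Q ∈ regChartDom n d i)
    (hR : ‖fun j => regChartFun n d i Q (Sum.inr j)‖ ≤ R) :
    hypersurfacePoint (regularToProjectiveSpace ℂ n d) Q ∈
      Projectivization.stdChartInv i '' Metric.closedBall (0 : Fin (n + 1) → ℂ) R := by
  rw [regChartDom_eq_preimage] at hQ
  refine ⟨fun j => regChartFun n d i Q (Sum.inr j), by simpa using hR, ?_⟩
  change Projectivization.stdChartInv i (Projectivization.stdChart i (hypersurfacePoint (regularToProjectiveSpace ℂ n d) Q)) = _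
  rw [← Projectivization.stdChart_symm_apply]
  exact (Projectivization.stdChart i).left_inv hQ

/-! ### Extension by zero of functions of the chart coordinates -/

/-- **`B` read through the `i`-th chart and extended by zero**: `Q ↦ B(regChartFun Q)` on `𝒴°(ℂ)ᵢ`, `0` elsewhere.
[cite: BrockerJanichIDT1982, §7] -/
def regChartExtend {F : Type*} [Zero F] (B : (({m : DegIndex n d // m ≠ regPowIndex n d i} ⊕ Fin (n + 1)) → ℂ) → F)
    (Q : ComplexPoints (regularTotal ℂ n d)) : F :=
  by classical exact if Q ∈ regChartDom n d i then B (regChartFun n d i Q) else 0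

/-- On the chart domain the extension is `B ∘ regChartFun`. [cite: BrockerJanichIDT1982, §7] -/
theorem regChartExtend_of_mem {F : Type*} [Zero F] (B : (({m : DegIndex n d // m ≠ regPowIndex n d i} ⊕ Fin (n + 1)) → ℂ) → F)
    {Q : ComplexPoints (regularTotal ℂ n d)} (hQ : Q ∈ regChartDom n d i) :
    regChartExtend n d i B Q = B (regChartFun n d i Q) := by
  classical
  simp [regChartExtend, hQ]

/-- Off the chart domain the extension vanishes. [cite: BrockerJanichIDT1982, §7] -/
theorem regChartExtend_of_not_mem {F : Type*} [Zero F] (B : (({m : DegIndex n d // m ≠ regPowIndex n d i} ⊕ Fin (n + 1)) → ℂ) → F)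
    {Q : ComplexPoints (regularTotal ℂ n d)} (hQ : Q ∉ regChartDom n d i) :
    regChartExtend n d i B Q = 0 := by
  classical
  simp [regChartExtend, hQ]

/-- **Support control**: if `B(b', y) = 0` whenever `‖y‖ > R`, the topological support of the extension lies in the closed set of points
with homogeneous coordinates in `stdChartInv i (closedBall 0 R)`, inside `𝒴°(ℂ)ᵢ`. [cite: BrockerJanichIDT1982, §7] -/
theorem tsupport_regChartExtend_subset {F : Type*} [Zero F] [TopologicalSpace F]
    (B : (({m : DegIndex n d // m ≠ regPowIndex n d i} ⊕ Fin (n + 1)) → ℂ) → F) {R : ℝ}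
    (hB : ∀ v, R < ‖fun j => v (Sum.inr j)‖ → B v = 0) :
    tsupport (regChartExtend n d i B) ⊆
      {Q : ComplexPoints (regularTotal ℂ n d) |
        hypersurfacePoint (regularToProjectiveSpace ℂ n d) Q ∈
          Projectivization.stdChartInv i '' Metric.closedBall (0 : Fin (n + 1) → ℂ) R} := by
  refine closure_minimal (fun Q hQ => ?_) (isClosed_setOf_hypersurfacePoint_mem_image n d i R)
  rw [Function.mem_support] at hQ
  have hQi : Q ∈ regChartDom n d i := by
    by_contra h
    exact hQ (regChartExtend_of_not_mem n d i B h)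
  refine mem_setOf_hypersurfacePoint_mem_image n d i hQi (not_lt.mp fun hlt => hQ ?_)
  rw [regChartExtend_of_mem n d i B hQi]
  exact hB _ hlt

/-- The topological support lies in the chart domain. [cite: BrockerJanichIDT1982, §7] -/
theorem tsupport_regChartExtend_subset_regChartDom {F : Type*} [Zero F] [TopologicalSpace F]
    (B : (({m : DegIndex n d // m ≠ regPowIndex n d i} ⊕ Fin (n + 1)) → ℂ) → F) {R : ℝ}
    (hB : ∀ v, R < ‖fun j => v (Sum.inr j)‖ → B v = 0) :
    tsupport (regChartExtend n d i B) ⊆ regChartDom n d i :=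
  (tsupport_regChartExtend_subset n d i B hB).trans (setOf_hypersurfacePoint_mem_image_subset_regChartDom n d i R)

/-- **The extension by zero of a `C^∞` function of the chart coordinates with bounded affine support is `C^∞` on `𝒴°(ℂ)`** (`d ≥ 1`):
on the chart domain it is `B ∘ regChartFun` (`contMDiffAt_regChartFun`), off the topological support it is locally `0`
(`contMDiffAt_of_notMem`). [cite: BrockerJanichIDT1982, §7] [cite: SerreGAGA1956, §2 n°6] -/
theorem contMDiff_regChartExtend (hd : 0 < d) {F : Type*} [NormedAddCommGroup F] [NormedSpace ℝ F]
    (B : (({m : DegIndex n d // m ≠ regPowIndex n d i} ⊕ Fin (n + 1)) → ℂ) → F) (hBs : ContDiff ℝ ∞ B) {R : ℝ}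
    (hB : ∀ v, R < ‖fun j => v (Sum.inr j)‖ → B v = 0) :
    haveI := locallyOfFiniteType_regularTotal_hom ℂ n d hd
    haveI := smoothOfRelativeDimension_regularTotal_hom ℂ n d hd
    letI := ComplexPoints.chartedSpace (regularTotal ℂ n d) (n + Fintype.card (DegIndex n d))
    ContMDiff (𝓡 (2 * (n + Fintype.card (DegIndex n d)))) 𝓘(ℝ, F) ∞ (regChartExtend n d i B) := by
  haveI := locallyOfFiniteType_regularTotal_hom ℂ n d hd
  haveI := smoothOfRelativeDimension_regularTotal_hom ℂ n d hd
  letI := ComplexPoints.chartedSpace (regularTotal ℂ n d) (n + Fintype.card (DegIndex n d))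
  haveI := ComplexPoints.isManifold_real (regularTotal ℂ n d) (n + Fintype.card (DegIndex n d))
  intro Q
  by_cases hQ : Q ∈ tsupport (regChartExtend n d i B)
  · have hQi : Q ∈ regChartDom n d i := tsupport_regChartExtend_subset_regChartDom n d i B hB hQ
    have h1 : ContMDiffAt (𝓡 (2 * (n + Fintype.card (DegIndex n d)))) 𝓘(ℝ, F) ∞ (B ∘ regChartFun n d i) Q :=
      (hBs.contMDiff.contMDiffAt).comp Q (contMDiffAt_regChartFun n d i hd hQi)
    refine h1.congr_of_eventuallyEq ?_
    filter_upwards [(isOpen_regChartDom n d i).mem_nhds hQi] with Q' hQ'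
    exact regChartExtend_of_mem n d i B hQ'
  · exact contMDiffAt_of_notMem hQ ∞

/-- The real-valued case packaged with its value on the chart domain: for `Q ∈ 𝒴°(ℂ)ᵢ`, `regChartExtend n d i B Q = B (regChartFun Q)`,
and the function is `C^∞`. [cite: BrockerJanichIDT1982, §7] -/
theorem contMDiff_regChartExtend_real (hd : 0 < d) (B : (({m : DegIndex n d // m ≠ regPowIndex n d i} ⊕ Fin (n + 1)) → ℂ) → ℝ)
    (hBs : ContDiff ℝ ∞ B) {R : ℝ} (hB : ∀ v, R < ‖fun j => v (Sum.inr j)‖ → B v = 0) :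
    haveI := locallyOfFiniteType_regularTotal_hom ℂ n d hd
    haveI := smoothOfRelativeDimension_regularTotal_hom ℂ n d hd
    letI := ComplexPoints.chartedSpace (regularTotal ℂ n d) (n + Fintype.card (DegIndex n d))
    ContMDiff (𝓡 (2 * (n + Fintype.card (DegIndex n d)))) 𝓘(ℝ, ℝ) ∞ (regChartExtend n d i B) :=
  contMDiff_regChartExtend n d i hd B hBs hB

end Literature.AlgebraicGeometry.Motives.UniversalHypersurface

end
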